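import Mathlib
import HarnessLib
import Summits.Ventures.LatticeQCDFlow.Scoring.ChainMeanSquareError

/-!
# What discarding `B` initial samples buys, certified: the start-dependent term of the mean-square
# error shrinks by `(1 − ε/2)^B`, the leading term does not move —
# `E_{μ₀}[(A_{B,N} − πf)²] ≤ (2/ε − 1) Var_π f / N + 16 C'² (1 − ε/2)^B/(ε² N²)`

HONEST FRAMING: exact (Metropolis-corrected) sampling algorithms for lattice gauge theory;
figures of merit are autocorrelation/cost numbers at stated couplings and volumes; no
continuum-physics claim.

Venture `LatticeQCDFlow` (cell pub-lqcd), topic `Scoring`; FANOUT row 8 (`s0-cpn-nemc`, GEN-13).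
NEW WORK of the cell, not a published result; no definition is introduced.  A quantitative burn-in
statement for the simulated chain (Mathlib's `Kernel.trajMeasure`) of a Markov kernel minorised by
its invariant law, from any initial law: the time average over the window `X_B, …, X_{B+N−1}`.
Inputs: the pair bound of `Scoring/ChainMeanSquareError.lean`
(`abs_chain_pair_sub_autocov_le_of_doeblin`: `|E_{μ₀}[g(X_i)g(X_j)] − C_g(|i−j|)| ≤ 2C'²(1−ε/2)^{max i j}`,
now used at shifted times `B + i`, `B + j`), its pair counts (`sum_sum_max`,
`sum_range_odd_mul_pow_le`) and the `L²` envelope (`Scoring/DoeblinAutocorrelation.lean`).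
Nothing is cited as a fact.

## Content (`κ` Markov, `π` invariant, `κ(x, ·) ≥ ε π`, `ε > 0`; `μ₀` ANY probability law;
## `|f| ≤ C`, `C' = C + |πf|`; `A_{B,N} = (1/N) Σ_{i<N} f(X_{B+i})`, `N ≥ 1`, `B ≥ 0`)

* `chain_sqError_shifted_eq` — `E_{μ₀}[(A_{B,N} − m)²] =
  (1/N²) Σ_{i,j<N} E_{μ₀}[(f(X_{B+i}) − m)(f(X_{B+j}) − m)]` for every constant `m`;
* **`chain_mse_shifted_le_of_doeblin`** —
  `E_{μ₀}[(A_{B,N} − πf)²] ≤ (2/ε − 1) · Var_π f / N + 16 C'² (1 − ε/2)^B / (ε² N²)`.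

Reading (value-free): for a sampler with a Doeblin certificate the thermalisation cut is a
second-order economy — it multiplies the start-dependent `1/N²` term by `(1 − ε/2)^B` and leaves the
`(2/ε − 1) Var_π f/N` term untouched; the honest error bar of a run is set by `N`, not by `B`.  NOT
CLAIMED: any `ε` for a concrete sampler; that discarding is useless for samplers WITHOUT a uniform
certificate (metastable starts); unbounded observables.
-/

noncomputable section

namespace Summit.Ventures.LatticeQCDFlow.Scoring

open MeasureTheory ProbabilityTheory Filter Finset Preorder
open scoped ENNReal

variable {Ω : Type*} [MeasurableSpace Ω]
variable {κ : Kernel Ω Ω} [IsMarkovKernel κ] {μ₀ : Measure Ω} [IsProbabilityMeasure μ₀]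

/-- The squared error of the shifted time average about a constant `m` is a double sum of two-time
moments at shifted times. -/
theorem chain_sqError_shifted_eq {f : Ω → ℝ} (hf : Measurable f) {C : ℝ} (hC : ∀ x, |f x| ≤ C)
    (m : ℝ) (B : ℕ) {N : ℕ} (hN : N ≠ 0) :
    ∫ x, ((∑ i ∈ Finset.range N, f (x (B + i))) / N - m) ^ 2
        ∂(Kernel.trajMeasure (X := fun _ : ℕ => Ω) μ₀
          (fun n : ℕ => κ.comap (fun h : (i : ↥(Finset.Iic n)) → Ω => h ⟨n, Finset.mem_Iic.2 le_rfl⟩)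
            (measurable_pi_apply _)))
      = (∑ i ∈ Finset.range N, ∑ j ∈ Finset.range N,
          ∫ x, (f (x (B + i)) - m) * (f (x (B + j)) - m)
            ∂(Kernel.trajMeasure (X := fun _ : ℕ => Ω) μ₀
              (fun n : ℕ => κ.comap (fun h : (i : ↥(Finset.Iic n)) → Ω => h ⟨n, Finset.mem_Iic.2 le_rfl⟩)
                (measurable_pi_apply _)))) / (N : ℝ) ^ 2 := by
  set P := Kernel.trajMeasure (X := fun _ : ℕ => Ω) μ₀
      (fun n : ℕ => κ.comap (fun h : (i : ↥(Finset.Iic n)) → Ω => h ⟨n, Finset.mem_Iic.2 le_rfl⟩)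
        (measurable_pi_apply _)) with hP
  have hN' : (N : ℝ) ≠ 0 := by exact_mod_cast hN
  have hgb : ∀ y, |f y - m| ≤ C + |m| := fun y => (abs_sub _ _).trans (add_le_add (hC y) le_rfl)
  have hint : ∀ i j, Integrable (fun x : ℕ → Ω => (f (x (B + i)) - m) * (f (x (B + j)) - m)) P :=
    fun i j => integrable_of_bounded P
      (((hf.comp (measurable_pi_apply (B + i))).sub measurable_const).mul
        ((hf.comp (measurable_pi_apply (B + j))).sub measurable_const)) (C := (C + |m|) * (C + |m|))
      fun x => by
        rw [abs_mul]
        exact mul_le_mul (hgb _) (hgb _) (abs_nonneg _) ((abs_nonneg _).trans (hgb (x (B + i))))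
  have hpt : ∀ x : ℕ → Ω, ((∑ i ∈ Finset.range N, f (x (B + i))) / N - m) ^ 2
      = (∑ i ∈ Finset.range N, ∑ j ∈ Finset.range N, (f (x (B + i)) - m) * (f (x (B + j)) - m))
          / (N : ℝ) ^ 2 := by
    intro x
    have h1 : (∑ i ∈ Finset.range N, f (x (B + i))) / N - m
        = (∑ i ∈ Finset.range N, (f (x (B + i)) - m)) / N := by
      rw [Finset.sum_sub_distrib, Finset.sum_const, Finset.card_range, nsmul_eq_mul]
      field_simp
    rw [h1, div_pow, sq (∑ i ∈ Finset.range N, (f (x (B + i)) - m)), Finset.sum_mul_sum]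
  rw [integral_congr_ae (ae_of_all _ hpt), integral_div, integral_finsetSum _ fun i _ =>
    integrable_finsetSum _ fun j _ => hint i j]
  congr 1
  exact Finset.sum_congr rfl fun i _ => integral_finsetSum _ fun j _ => hint i j

/-- **WHAT THE BURN-IN CUT BUYS.**  With `π` invariant, `κ(x, ·) ≥ ε π` (`ε > 0`), `|f| ≤ C`: for
EVERY initial law `μ₀`, every `B` and every `N ≥ 1`,
`E_{μ₀}[((1/N) Σ_{i<N} f(X_{B+i}) − πf)²] ≤ (2/ε − 1) · Var_π f / N + 16 (C + |πf|)² (1 − ε/2)^B / (ε² N²)`. -/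
theorem chain_mse_shifted_le_of_doeblin {π : Measure Ω} [IsProbabilityMeasure π]
    (hπ : Kernel.Invariant κ π) {ε : ℝ≥0∞}
    (hmin : ∀ x {B : Set Ω}, MeasurableSet B → ε * π B ≤ κ x B) (hε0 : 0 < ε)
    {f : Ω → ℝ} (hf : Measurable f) {C : ℝ} (hC : ∀ x, |f x| ≤ C) (B : ℕ) {N : ℕ} (hN : N ≠ 0) :
    ∫ x, ((∑ i ∈ Finset.range N, f (x (B + i))) / N - ∫ z, f z ∂π) ^ 2
        ∂(Kernel.trajMeasure (X := fun _ : ℕ => Ω) μ₀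
          (fun n : ℕ => κ.comap (fun h : (i : ↥(Finset.Iic n)) → Ω => h ⟨n, Finset.mem_Iic.2 le_rfl⟩)
            (measurable_pi_apply _)))
      ≤ (2 / ε.toReal - 1) * autocov κ π (fun y => f y - ∫ z, f z ∂π) 0 / N
        + 16 * (C + |∫ z, f z ∂π|) ^ 2 * (1 - (ε / 2).toReal) ^ B / (ε.toReal ^ 2 * (N : ℝ) ^ 2) := by
  set P := Kernel.trajMeasure (X := fun _ : ℕ => Ω) μ₀
      (fun n : ℕ => κ.comap (fun h : (i : ↥(Finset.Iic n)) → Ω => h ⟨n, Finset.mem_Iic.2 le_rfl⟩)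
        (measurable_pi_apply _)) with hP
  set m := ∫ z, f z ∂π with hm
  set g := fun y => f y - m with hg
  set r := 1 - (ε / 2).toReal with hrdef
  have hgm : Measurable g := hf.sub measurable_const
  have hgb : ∀ y, |g y| ≤ C + |m| := fun y => (abs_sub _ _).trans (add_le_add (hC y) le_rfl)
  have hg0 : ∫ y, g y ∂π = 0 := by
    rw [hg, integral_sub (integrable_of_bounded π hf hC) (integrable_const _), integral_const,
      probReal_univ, one_smul, hm, sub_self]
  obtain ⟨-, hl0, hl1, -, hr, hεr0⟩ := half_const_bounds hmin hε0
  rw [← hrdef] at hl0 hl1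
  have hk0 : 0 ≤ 1 - ε.toReal := one_sub_toReal_nonneg_of_doeblin hmin
  have hk1 : 1 - ε.toReal < 1 := by linarith
  have hNpos : (0 : ℝ) < N := by exact_mod_cast Nat.pos_of_ne_zero hN
  have hσ0 : 0 ≤ autocov κ π g 0 := by rw [autocov_zero]; exact integral_nonneg fun _ => sq_nonneg _
  have hrB : 0 ≤ r ^ B := pow_nonneg hl0 B
  -- (1) double sum of shifted two-time moments
  have hsq := chain_sqError_shifted_eq (κ := κ) (μ₀ := μ₀) hf hC m B hN
  rw [← hP] at hsq
  -- (2) shifted pair bound: the extra factor `r^B`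
  have hpair : ∀ i j, ∫ x, g (x (B + i)) * g (x (B + j)) ∂P
      ≤ autocov κ π g (Nat.dist i j) + 2 * (C + |m|) ^ 2 * r ^ B * r ^ (max i j) := by
    intro i j
    have h := abs_chain_pair_sub_autocov_le_of_doeblin (μ₀ := μ₀) hπ hmin hε0 hgm hgb hg0 (B + i) (B + j)
    rw [← hP, Nat.dist_add_add_left, ← hrdef, Nat.add_max_add_left, pow_add] at h
    linarith [(abs_le.1 h).2]
  -- (3) stationary double sum ≤ N (2/ε − 1) C_g(0)
  have henv : ∀ t, |autocov κ π g t| ≤ (1 - ε.toReal) ^ t * autocov κ π g 0 := fun t => by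
    rw [autocov_zero]; exact abs_autocov_le_of_doeblin hπ hmin hgm hgb hg0 t
  have hstat : ∑ i ∈ Finset.range N, ∑ j ∈ Finset.range N, autocov κ π g (Nat.dist i j)
      ≤ N * ((2 / ε.toReal - 1) * autocov κ π g 0) := by
    rw [sum_sum_dist]
    have hterm : ∀ t ∈ Finset.range N, ((N : ℝ) - (t + 1)) * autocov κ π g (t + 1)
        ≤ N * ((1 - ε.toReal) ^ (t + 1) * autocov κ π g 0) := by
      intro t ht
      have ht' : (t : ℝ) + 1 ≤ N := by exact_mod_cast Finset.mem_range.1 ht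
      have h1 : ((N : ℝ) - (t + 1)) * autocov κ π g (t + 1)
          ≤ ((N : ℝ) - (t + 1)) * |autocov κ π g (t + 1)| :=
        mul_le_mul_of_nonneg_left (le_abs_self _) (by linarith)
      have h2 : ((N : ℝ) - (t + 1)) * |autocov κ π g (t + 1)| ≤ N * |autocov κ π g (t + 1)| :=
        mul_le_mul_of_nonneg_right (by linarith) (abs_nonneg _)
      exact h1.trans (h2.trans (mul_le_mul_of_nonneg_left (henv (t + 1)) hNpos.le))
    have hlag : ∑ t ∈ Finset.range N, ((N : ℝ) - (t + 1)) * autocov κ π g (t + 1)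
        ≤ N * ((1 / ε.toReal - 1) * autocov κ π g 0) := by
      refine (Finset.sum_le_sum hterm).trans ?_
      rw [← Finset.mul_sum, ← Finset.sum_mul]
      refine mul_le_mul_of_nonneg_left (mul_le_mul_of_nonneg_right ?_ hσ0) hNpos.le
      have habs : |1 - ε.toReal| < 1 := by rw [abs_of_nonneg hk0]; exact hk1
      have hs := sum_le_hasSum (Finset.range N) (fun t _ => pow_nonneg hk0 (t + 1))
        (hasSum_geometric_succ habs)
      have hε' : (1 - ε.toReal) / (1 - (1 - ε.toReal)) = 1 / ε.toReal - 1 := by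
        rw [sub_sub_cancel, sub_div, div_self hεr0.ne']
      linarith
    have h2 : (N : ℝ) * ((2 / ε.toReal - 1) * autocov κ π g 0)
        = N * autocov κ π g 0 + 2 * (N * ((1 / ε.toReal - 1) * autocov κ π g 0)) := by ring
    rw [h2]
    linarith
  -- (4) correction double sum ≤ 8/ε²
  have hcorr : ∑ i ∈ Finset.range N, ∑ j ∈ Finset.range N, r ^ (max i j) ≤ 8 / ε.toReal ^ 2 := by
    rw [sum_sum_max (fun k => r ^ k) N]
    refine (sum_range_odd_mul_pow_le hl0 hl1 N).trans ?_
    rw [hrdef, hr, show 1 - (1 - ε.toReal / 2) = ε.toReal / 2 by ring,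
      div_le_div_iff₀ (by positivity) (by positivity)]
    nlinarith [hεr0, sq_nonneg ε.toReal]
  -- (5) assemble
  have hsum : ∑ i ∈ Finset.range N, ∑ j ∈ Finset.range N, ∫ x, g (x (B + i)) * g (x (B + j)) ∂P
      ≤ N * ((2 / ε.toReal - 1) * autocov κ π g 0)
        + 2 * (C + |m|) ^ 2 * r ^ B * (8 / ε.toReal ^ 2) := by
    calc ∑ i ∈ Finset.range N, ∑ j ∈ Finset.range N, ∫ x, g (x (B + i)) * g (x (B + j)) ∂P
        ≤ ∑ i ∈ Finset.range N, ∑ j ∈ Finset.range N,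
            (autocov κ π g (Nat.dist i j) + 2 * (C + |m|) ^ 2 * r ^ B * r ^ (max i j)) :=
          Finset.sum_le_sum fun i _ => Finset.sum_le_sum fun j _ => hpair i j
      _ = ∑ i ∈ Finset.range N, ∑ j ∈ Finset.range N, autocov κ π g (Nat.dist i j)
          + 2 * (C + |m|) ^ 2 * r ^ B
            * ∑ i ∈ Finset.range N, ∑ j ∈ Finset.range N, r ^ (max i j) := by
          rw [Finset.mul_sum, ← Finset.sum_add_distrib]
          refine Finset.sum_congr rfl fun i _ => ?_
          rw [Finset.mul_sum, ← Finset.sum_add_distrib]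
      _ ≤ _ := add_le_add hstat (mul_le_mul_of_nonneg_left hcorr (by positivity))
  have hgoal : ∫ x, ((∑ i ∈ Finset.range N, f (x (B + i))) / N - m) ^ 2 ∂P
      = (∑ i ∈ Finset.range N, ∑ j ∈ Finset.range N, ∫ x, g (x (B + i)) * g (x (B + j)) ∂P)
        / (N : ℝ) ^ 2 := hsq
  rw [hgoal, div_le_iff₀ (by positivity)]
  rw [show ((2 / ε.toReal - 1) * autocov κ π g 0 / N
        + 16 * (C + |m|) ^ 2 * r ^ B / (ε.toReal ^ 2 * (N : ℝ) ^ 2)) * (N : ℝ) ^ 2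
      = N * ((2 / ε.toReal - 1) * autocov κ π g 0) + 2 * (C + |m|) ^ 2 * r ^ B * (8 / ε.toReal ^ 2) by
    field_simp; ring]
  exact hsum

end Summit.Ventures.LatticeQCDFlow.Scoring

end
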